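import Summits.Ventures.PercRepro.C026T3
import Summits.Ventures.PercRepro.C026G2QuantSym

/-!
# THEOREM T3′ in the state algebra: C-028 on the symmetric triangle of two different super-vertices
(p6, gen 15; mine-3 MINE3-GLUING v11 §16)

The triangle «bare probe joined by edges of weights `p₀`, `p₂` to the roots of two `a ↔ b`-symmetric
states `B`, `C`, joined to each other by an edge of weight `p`» has the state
`M(p) = (1 − p)·(S_{p₀}B ⊙ S_{p₂}C) + p·S_q(B ⊙ C)`, `q = p₀ + p₂ − p₀p₂` (the (N)-step at `v₁v₂`), with
`π_K = p₂(1 − p₀)k_C(1 − k_B) + p₀(1 − p₂)k_B(1 − k_C)` and `π_n̄ = 2(1 − p₀p₂)Y_B Y_C`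
(`triangle2_pivots`).  With C-028 AND Harris on `B`, `C`, LEMMA G2-QUANT (`g2quantSym`) gives
`Δ(B ⊙ C) ≥ 2Y_B Y_C·max(k_C(1 − k_B), k_B(1 − k_C))`, and since
`q − (1 − p₀p₂)(p₀ + p₂ − 2p₀p₂) = p₀p₂(1 + p₀ + p₂ − 2p₀p₂) ≥ 0`, `Δ(M₁) ≥ π_K π_n̄`; `Δ(M₀) ≥ 0` by
LEMMA G2.  **`t3prime_slack_nonneg`: `Δ(M(p)) ≥ 0`** — C-028 on the symmetric triangle at every weight.
-/

namespace PercRepro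

open SymState

/-- Harris for a symmetric state: `Z ≥ K·n̄`, i.e. `z ≥ k(2a − z)`. -/
def SymState.harris (σ : SymState) : Prop := σ.k * (2 * σ.a - σ.z) ≤ σ.z

/-- The state of the symmetric triangle with c-edges `p₀`, `p₂` and the edge `v₁v₂` of weight `p`. -/
def triangleState2 (p₀ p₂ p : ℝ) (B C : SymState) : SymState :=
  SymState.mixS p (SymState.glue (SymState.series p₀ B) (SymState.series p₂ C))
    (SymState.series (p₀ + p₂ - p₀ * p₂) (SymState.glue B C))

/-- The pivotal differences of `v₁v₂`. -/
theorem triangle2_pivots (p₀ p₂ : ℝ) (B C : SymState) :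
    (SymState.glue (SymState.series p₀ B) (SymState.series p₂ C)).k -
        (SymState.series (p₀ + p₂ - p₀ * p₂) (SymState.glue B C)).k =
        p₂ * (1 - p₀) * C.k * (1 - B.k) + p₀ * (1 - p₂) * B.k * (1 - C.k) ∧
      (SymState.glue (SymState.series p₀ B) (SymState.series p₂ C)).nbar -
        (SymState.series (p₀ + p₂ - p₀ * p₂) (SymState.glue B C)).nbar =
        2 * (1 - p₀ * p₂) * ((B.a - B.z) * (C.a - C.z)) := by
  constructor <;> (simp only [SymState.glue, SymState.series, SymState.nbar]; ring)

/-- The (N)-step identity for the symmetric triangle. -/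
theorem triangle2_slack_eq (p₀ p₂ p : ℝ) (B C : SymState) :
    (triangleState2 p₀ p₂ p B C).slack =
      (1 - p) * (SymState.glue (SymState.series p₀ B) (SymState.series p₂ C)).slack +
        p * ((p₀ + p₂ - p₀ * p₂) * (SymState.glue B C).slack) -
        p * (1 - p) * ((p₂ * (1 - p₀) * C.k * (1 - B.k) + p₀ * (1 - p₂) * B.k * (1 - C.k)) *
          (2 * (1 - p₀ * p₂) * ((B.a - B.z) * (C.a - C.z)))) := by
  unfold triangleState2
  rw [SymState.slack_mix, SymState.slack_series, (triangle2_pivots p₀ p₂ B C).1,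
    (triangle2_pivots p₀ p₂ B C).2]

/-- `Δ(B ⊙ C) = a_B a_C·(1 + 2k_B k_C − x_B x_C(2 + k_B k_C))` with `x = z/a`. -/
theorem slack_glue_eq (B C : SymState) (hB : B.a ≠ 0) (hC : C.a ≠ 0) :
    (SymState.glue B C).slack =
      B.a * C.a * (1 + 2 * B.k * C.k - (B.z / B.a) * (C.z / C.a) * (2 + B.k * C.k)) := by
  unfold SymState.slack SymState.glue
  field_simp
  try ring

/-- The band coordinates of a symmetric state with C-028 and Harris, `0 < z ≤ a`. -/
theorem band_of_state (σ : SymState) (hz : 0 < σ.z) (hza : σ.z ≤ σ.a) (hk0 : 0 ≤ σ.k)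
    (hC : 0 ≤ σ.slack) (hH : σ.harris) :
    kLo (σ.z / σ.a) ≤ σ.k ∧ σ.k ≤ kHi (σ.z / σ.a) := by
  have ha : 0 < σ.a := lt_of_lt_of_le hz hza
  have hx1 : σ.z / σ.a ≤ 1 := by rw [div_le_one ha]; exact hza
  have hd : 0 < 2 - σ.z / σ.a := by linarith
  constructor
  · unfold kLo
    refine max_le hk0 ?_
    rw [div_le_iff₀ hd]
    -- `(2x − 1) ≤ k(2 − x)` is `Δ ≥ 0` divided by `a`
    unfold SymState.slack at hC
    have e : (2 * (σ.z / σ.a) - 1) = (σ.k * (2 - σ.z / σ.a)) -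
        (σ.a * (1 + 2 * σ.k) - σ.z * (2 + σ.k)) / σ.a := by
      field_simp
      ring
    rw [e]
    have : 0 ≤ (σ.a * (1 + 2 * σ.k) - σ.z * (2 + σ.k)) / σ.a := div_nonneg hC ha.le
    linarith
  · unfold kHi
    rw [le_div_iff₀ hd]
    -- Harris `k(2a − z) ≤ z` divided by `a`
    unfold SymState.harris at hH
    have e : σ.k * (2 - σ.z / σ.a) = (σ.k * (2 * σ.a - σ.z)) / σ.a := by
      field_simp
    rw [e, div_le_iff₀ ha, div_mul_cancel₀ _ ha.ne']
    exact hH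

/-- **LEMMA G2-QUANT in state form**: for symmetric `B`, `C` with `0 < z ≤ a`, `0 ≤ k`, C-028 and Harris,
`Δ(B ⊙ C) ≥ 2Y_B Y_C·max(k_C(1 − k_B), k_B(1 − k_C))`. -/
theorem slack_glue_ge (B C : SymState) (hBz : 0 < B.z) (hBa : B.z ≤ B.a) (hBk : 0 ≤ B.k)
    (hBC : 0 ≤ B.slack) (hBH : B.harris) (hCz : 0 < C.z) (hCa : C.z ≤ C.a) (hCk : 0 ≤ C.k)
    (hCC : 0 ≤ C.slack) (hCH : C.harris) :
    2 * ((B.a - B.z) * (C.a - C.z)) * max (C.k * (1 - B.k)) (B.k * (1 - C.k)) ≤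
      (SymState.glue B C).slack := by
  have haB : 0 < B.a := lt_of_lt_of_le hBz hBa
  have haC : 0 < C.a := lt_of_lt_of_le hCz hCa
  obtain ⟨hB1, hB2⟩ := band_of_state B hBz hBa hBk hBC hBH
  obtain ⟨hC1, hC2⟩ := band_of_state C hCz hCa hCk hCC hCH
  have hxB0 : 0 ≤ B.z / B.a := div_nonneg hBz.le haB.le
  have hxB1 : B.z / B.a ≤ 1 := by rw [div_le_one haB]; exact hBa
  have hxC0 : 0 ≤ C.z / C.a := div_nonneg hCz.le haC.le
  have hxC1 : C.z / C.a ≤ 1 := by rw [div_le_one haC]; exact hCa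
  have hG := g2quantSym hxB0 hxB1 hxC0 hxC1 hB1 hB2 hC1 hC2
  rw [slack_glue_eq B C haB.ne' haC.ne']
  have e : (B.a - B.z) * (C.a - C.z) = B.a * C.a * ((1 - B.z / B.a) * (1 - C.z / C.a)) := by
    field_simp
    try ring
  rw [e]
  have hpos : 0 ≤ B.a * C.a := by positivity
  calc 2 * (B.a * C.a * ((1 - B.z / B.a) * (1 - C.z / C.a))) *
        max (C.k * (1 - B.k)) (B.k * (1 - C.k))
      = B.a * C.a * (2 * (1 - B.z / B.a) * (1 - C.z / C.a) *
          max (C.k * (1 - B.k)) (B.k * (1 - C.k))) := by ring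
    _ ≤ B.a * C.a * (1 + 2 * B.k * C.k - (B.z / B.a) * (C.z / C.a) * (2 + B.k * C.k)) :=
      mul_le_mul_of_nonneg_left hG hpos

/-- `Δ(M₀) ≥ 0` for the gluing of two series states (LEMMA G2), with the `z = 0` cases. -/
theorem slack_glue_series2_nonneg (p₀ p₂ : ℝ) (h00 : 0 ≤ p₀) (h01 : p₀ ≤ 1) (h20 : 0 ≤ p₂)
    (h21 : p₂ ≤ 1) (B C : SymState) (hBz : 0 ≤ B.z) (hBa : B.z ≤ B.a) (hBk : 0 ≤ B.k)
    (hBC : 0 ≤ B.slack) (hCz : 0 ≤ C.z) (hCa : C.z ≤ C.a) (hCk : 0 ≤ C.k) (hCC : 0 ≤ C.slack) :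
    0 ≤ (SymState.glue (SymState.series p₀ B) (SymState.series p₂ C)).slack := by
  set σ := SymState.series p₀ B with hσ
  set τ := SymState.series p₂ C with hτ
  have hσz : 0 ≤ σ.z := by rw [hσ]; simp only [SymState.series]; nlinarith
  have hσa : σ.z ≤ σ.a := by rw [hσ]; simp only [SymState.series]; nlinarith
  have hσk : 0 ≤ σ.k := by rw [hσ]; simp only [SymState.series]; nlinarith
  have hσC : 0 ≤ σ.slack := by rw [hσ, SymState.slack_series]; exact mul_nonneg h00 hBC
  have hτz : 0 ≤ τ.z := by rw [hτ]; simp only [SymState.series]; nlinarith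
  have hτa : τ.z ≤ τ.a := by rw [hτ]; simp only [SymState.series]; nlinarith
  have hτk : 0 ≤ τ.k := by rw [hτ]; simp only [SymState.series]; nlinarith
  have hτC : 0 ≤ τ.slack := by rw [hτ, SymState.slack_series]; exact mul_nonneg h20 hCC
  -- degenerate cases: a vanishing `z` gives `Δ(glue) = a_σ a_τ (1 + 2 k_σ k_τ) − z_σ z_τ(2 + k_σ k_τ)`
  have hform : (SymState.glue σ τ).slack =
      σ.a * τ.a * (1 + 2 * σ.k * τ.k) - σ.z * τ.z * (2 + σ.k * τ.k) := by
    unfold SymState.slack SymState.glue; ring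
  rcases hσz.lt_or_eq with hσpos | hσzero
  · rcases hτz.lt_or_eq with hτpos | hτzero
    · have hσa0 : 0 < σ.a := lt_of_lt_of_le hσpos hσa
      have hτa0 : 0 < τ.a := lt_of_lt_of_le hτpos hτa
      have hphiσ := (SymState.slack_nonneg_iff_phi σ hσpos hσa).1 hσC
      have hphiτ := (SymState.slack_nonneg_iff_phi τ hτpos hτa).1 hτC
      have hxσ0 : 0 ≤ σ.z / σ.a := div_nonneg hσpos.le hσa0.le
      have hxσ1 : σ.z / σ.a ≤ 1 := by rw [div_le_one hσa0]; exact hσa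
      have hxτ0 : 0 ≤ τ.z / τ.a := div_nonneg hτpos.le hτa0.le
      have hxτ1 : τ.z / τ.a ≤ 1 := by rw [div_le_one hτa0]; exact hτa
      have hG2 := c028Phi_mul_le hxσ0 hxσ1 hxσ0 hxσ1 hxτ0 hxτ1 hxτ0 hxτ1
      have hzz : 0 < (SymState.glue σ τ).z := by simp only [SymState.glue]; positivity
      have hza' : (SymState.glue σ τ).z ≤ (SymState.glue σ τ).a := by
        simp only [SymState.glue]; exact mul_le_mul hσa hτa hτpos.le hσa0.le
      rw [SymState.slack_nonneg_iff_phi _ hzz hza']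
      have e : (SymState.glue σ τ).z / (SymState.glue σ τ).a = σ.z / σ.a * (τ.z / τ.a) := by
        simp only [SymState.glue]; rw [div_mul_div_comm]
      rw [e]
      refine le_trans hG2 ?_
      have hmσ : max (c028Phi (σ.z / σ.a) (σ.z / σ.a)) 0 ≤ σ.k := max_le hphiσ hσk
      have hmτ : max (c028Phi (τ.z / τ.a) (τ.z / τ.a)) 0 ≤ τ.k := max_le hphiτ hτk
      calc max (c028Phi (σ.z / σ.a) (σ.z / σ.a)) 0 * max (c028Phi (τ.z / τ.a) (τ.z / τ.a)) 0
          ≤ σ.k * τ.k := mul_le_mul hmσ hmτ (le_max_right _ _) hσk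
        _ = (SymState.glue σ τ).k := by simp only [SymState.glue]
    · rw [hform, ← hτzero]
      have hA : 0 ≤ σ.a := le_trans hσz hσa
      have hB : 0 ≤ τ.a := le_trans hτz hτa
      have h := mul_nonneg (mul_nonneg hA hB)
        (by nlinarith [mul_nonneg hσk hτk] : (0 : ℝ) ≤ 1 + 2 * σ.k * τ.k)
      nlinarith [h]
  · rw [hform, ← hσzero]
    have hA : 0 ≤ σ.a := le_trans hσz hσa
    have hB : 0 ≤ τ.a := le_trans hτz hτa
    have h := mul_nonneg (mul_nonneg hA hB)
      (by nlinarith [mul_nonneg hσk hτk] : (0 : ℝ) ≤ 1 + 2 * σ.k * τ.k)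
    nlinarith [h]

/-- **THEOREM T3′ (state form)**: for symmetric `B`, `C` with `0 < z ≤ a`, `0 ≤ k ≤ 1`, C-028 and
Harris, the symmetric triangle satisfies C-028 at every `p₀, p₂, p ∈ [0, 1]`. -/
theorem t3prime_slack_nonneg (p₀ p₂ p : ℝ) (h00 : 0 ≤ p₀) (h01 : p₀ ≤ 1) (h20 : 0 ≤ p₂)
    (h21 : p₂ ≤ 1) (hp0 : 0 ≤ p) (hp1 : p ≤ 1) (B C : SymState)
    (hBz : 0 < B.z) (hBa : B.z ≤ B.a) (hBk0 : 0 ≤ B.k) (hBk1 : B.k ≤ 1) (hBC : 0 ≤ B.slack)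
    (hBH : B.harris) (hCz : 0 < C.z) (hCa : C.z ≤ C.a) (hCk0 : 0 ≤ C.k) (hCk1 : C.k ≤ 1)
    (hCC : 0 ≤ C.slack) (hCH : C.harris) :
    0 ≤ (triangleState2 p₀ p₂ p B C).slack := by
  rw [triangle2_slack_eq]
  have h0 := slack_glue_series2_nonneg p₀ p₂ h00 h01 h20 h21 B C hBz.le hBa hBk0 hBC hCz.le hCa
    hCk0 hCC
  have hQ := slack_glue_ge B C hBz hBa hBk0 hBC hBH hCz hCa hCk0 hCC hCH
  set Y := (B.a - B.z) * (C.a - C.z) with hY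
  have hY0 : 0 ≤ Y := by rw [hY]; exact mul_nonneg (by linarith) (by linarith)
  set M := max (C.k * (1 - B.k)) (B.k * (1 - C.k)) with hM
  have hM0 : 0 ≤ M := le_trans (mul_nonneg hCk0 (by linarith)) (le_max_left _ _)
  set q := p₀ + p₂ - p₀ * p₂ with hq
  set π := p₂ * (1 - p₀) * C.k * (1 - B.k) + p₀ * (1 - p₂) * B.k * (1 - C.k) with hπ
  -- `π ≤ (p₀ + p₂ − 2p₀p₂)·M`
  have hπM : π ≤ (p₀ + p₂ - 2 * p₀ * p₂) * M := by
    have h1 : C.k * (1 - B.k) ≤ M := le_max_left _ _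
    have h2 : B.k * (1 - C.k) ≤ M := le_max_right _ _
    have c1 : 0 ≤ p₂ * (1 - p₀) := mul_nonneg h20 (by linarith)
    have c2 : 0 ≤ p₀ * (1 - p₂) := mul_nonneg h00 (by linarith)
    rw [hπ]
    nlinarith [mul_le_mul_of_nonneg_left h1 c1, mul_le_mul_of_nonneg_left h2 c2]
  have hπ0 : 0 ≤ π := by
    rw [hπ]
    have := mul_nonneg (mul_nonneg (mul_nonneg h20 (sub_nonneg.2 h01)) hCk0) (sub_nonneg.2 hBk1)
    have := mul_nonneg (mul_nonneg (mul_nonneg h00 (sub_nonneg.2 h21)) hBk0) (sub_nonneg.2 hCk1)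
    linarith
  -- `q ≥ (1 − p₀p₂)(p₀ + p₂ − 2p₀p₂)`
  have hqq : (1 - p₀ * p₂) * (p₀ + p₂ - 2 * p₀ * p₂) ≤ q := by
    rw [hq]
    have e : q - (1 - p₀ * p₂) * (p₀ + p₂ - 2 * p₀ * p₂) = p₀ * p₂ * (1 + p₀ + p₂ - 2 * p₀ * p₂) := by
      rw [hq]; ring
    have : 0 ≤ p₀ * p₂ * (1 + p₀ + p₂ - 2 * p₀ * p₂) := by
      apply mul_nonneg (mul_nonneg h00 h20)
      nlinarith [mul_nonneg h00 (sub_nonneg.2 h21)]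
    linarith
  have h1p : 0 ≤ 1 - p₀ * p₂ := by nlinarith
  -- `Δ(M₁) = q·Δ(B ⊙ C) ≥ q·2YM ≥ (1 − p₀p₂)(p₀ + p₂ − 2p₀p₂)·2YM ≥ π·2Y(1 − p₀p₂) = π_K π_n̄`
  have hW0 : 0 ≤ 2 * (1 - p₀ * p₂) * Y := mul_nonneg (mul_nonneg (by norm_num) h1p) hY0
  have hkey : π * (2 * (1 - p₀ * p₂) * Y) ≤ q * (SymState.glue B C).slack := by
    have hq0 : 0 ≤ q := by rw [hq]; nlinarith [mul_nonneg h00 (sub_nonneg.2 h21)]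
    have s1 : q * (2 * Y * M) ≤ q * (SymState.glue B C).slack :=
      mul_le_mul_of_nonneg_left hQ hq0
    have hYM : 0 ≤ 2 * Y * M := mul_nonneg (mul_nonneg (by norm_num) hY0) hM0
    have s2 : (1 - p₀ * p₂) * (p₀ + p₂ - 2 * p₀ * p₂) * (2 * Y * M) ≤ q * (2 * Y * M) :=
      mul_le_mul_of_nonneg_right hqq hYM
    have s3 : π * (2 * (1 - p₀ * p₂) * Y) ≤
        (1 - p₀ * p₂) * (p₀ + p₂ - 2 * p₀ * p₂) * (2 * Y * M) := by
      have h := mul_le_mul_of_nonneg_right hπM hW0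
      have e : (p₀ + p₂ - 2 * p₀ * p₂) * M * (2 * (1 - p₀ * p₂) * Y) =
          (1 - p₀ * p₂) * (p₀ + p₂ - 2 * p₀ * p₂) * (2 * Y * M) := by ring
      rw [e] at h
      exact h
    exact le_trans s3 (le_trans s2 s1)
  have hp1' : 0 ≤ 1 - p := by linarith
  have hπn : 0 ≤ π * (2 * (1 - p₀ * p₂) * Y) := mul_nonneg hπ0 hW0
  have t1 : 0 ≤ (1 - p) * (SymState.glue (SymState.series p₀ B) (SymState.series p₂ C)).slack :=
    mul_nonneg hp1' h0
  have t2 : 0 ≤ p * (q * (SymState.glue B C).slack - π * (2 * (1 - p₀ * p₂) * Y)) :=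
    mul_nonneg hp0 (sub_nonneg.2 hkey)
  have t3 : 0 ≤ p * p * (π * (2 * (1 - p₀ * p₂) * Y)) := mul_nonneg (mul_nonneg hp0 hp0) hπn
  have e : (1 - p) * (SymState.glue (SymState.series p₀ B) (SymState.series p₂ C)).slack +
      p * (q * (SymState.glue B C).slack) - p * (1 - p) * (π * (2 * (1 - p₀ * p₂) * Y)) =
      (1 - p) * (SymState.glue (SymState.series p₀ B) (SymState.series p₂ C)).slack +
        p * (q * (SymState.glue B C).slack - π * (2 * (1 - p₀ * p₂) * Y)) +
        p * p * (π * (2 * (1 - p₀ * p₂) * Y)) := by ring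
  rw [e]
  exact add_nonneg (add_nonneg t1 t2) t3

/-- **LEMMA G2 in state form**: the gluing of two symmetric C-028 states (with `0 ≤ z ≤ a`, `0 ≤ k`)
satisfies C-028. -/
theorem slack_glue_nonneg (σ τ : SymState) (hσz : 0 ≤ σ.z) (hσa : σ.z ≤ σ.a) (hσk : 0 ≤ σ.k)
    (hσC : 0 ≤ σ.slack) (hτz : 0 ≤ τ.z) (hτa : τ.z ≤ τ.a) (hτk : 0 ≤ τ.k) (hτC : 0 ≤ τ.slack) :
    0 ≤ (SymState.glue σ τ).slack := by
  have hform : (SymState.glue σ τ).slack =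
      σ.a * τ.a * (1 + 2 * σ.k * τ.k) - σ.z * τ.z * (2 + σ.k * τ.k) := by
    unfold SymState.slack SymState.glue; ring
  rcases hσz.lt_or_eq with hσpos | hσzero
  · rcases hτz.lt_or_eq with hτpos | hτzero
    · have hσa0 : 0 < σ.a := lt_of_lt_of_le hσpos hσa
      have hτa0 : 0 < τ.a := lt_of_lt_of_le hτpos hτa
      have hphiσ := (SymState.slack_nonneg_iff_phi σ hσpos hσa).1 hσC
      have hphiτ := (SymState.slack_nonneg_iff_phi τ hτpos hτa).1 hτC
      have hxσ0 : 0 ≤ σ.z / σ.a := div_nonneg hσpos.le hσa0.le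
      have hxσ1 : σ.z / σ.a ≤ 1 := by rw [div_le_one hσa0]; exact hσa
      have hxτ0 : 0 ≤ τ.z / τ.a := div_nonneg hτpos.le hτa0.le
      have hxτ1 : τ.z / τ.a ≤ 1 := by rw [div_le_one hτa0]; exact hτa
      have hG2 := c028Phi_mul_le hxσ0 hxσ1 hxσ0 hxσ1 hxτ0 hxτ1 hxτ0 hxτ1
      have hzz : 0 < (SymState.glue σ τ).z := by simp only [SymState.glue]; positivity
      have hza' : (SymState.glue σ τ).z ≤ (SymState.glue σ τ).a := by
        simp only [SymState.glue]; exact mul_le_mul hσa hτa hτpos.le hσa0.le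
      rw [SymState.slack_nonneg_iff_phi _ hzz hza']
      have e : (SymState.glue σ τ).z / (SymState.glue σ τ).a = σ.z / σ.a * (τ.z / τ.a) := by
        simp only [SymState.glue]; rw [div_mul_div_comm]
      rw [e]
      refine le_trans hG2 ?_
      have hmσ : max (c028Phi (σ.z / σ.a) (σ.z / σ.a)) 0 ≤ σ.k := max_le hphiσ hσk
      have hmτ : max (c028Phi (τ.z / τ.a) (τ.z / τ.a)) 0 ≤ τ.k := max_le hphiτ hτk
      calc max (c028Phi (σ.z / σ.a) (σ.z / σ.a)) 0 * max (c028Phi (τ.z / τ.a) (τ.z / τ.a)) 0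
          ≤ σ.k * τ.k := mul_le_mul hmσ hmτ (le_max_right _ _) hσk
        _ = (SymState.glue σ τ).k := by simp only [SymState.glue]
    · rw [hform, ← hτzero]
      have hA : 0 ≤ σ.a := le_trans hσz hσa
      have hB : 0 ≤ τ.a := le_trans hτz hτa
      have h := mul_nonneg (mul_nonneg hA hB)
        (by nlinarith [mul_nonneg hσk hτk] : (0 : ℝ) ≤ 1 + 2 * σ.k * τ.k)
      nlinarith [h]
  · rw [hform, ← hσzero]
    have hA : 0 ≤ σ.a := le_trans hσz hσa
    have hB : 0 ≤ τ.a := le_trans hτz hτa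
    have h := mul_nonneg (mul_nonneg hA hB)
      (by nlinarith [mul_nonneg hσk hτk] : (0 : ℝ) ≤ 1 + 2 * σ.k * τ.k)
    nlinarith [h]

/-- Admissible symmetric states: `0 ≤ z ≤ a`, `0 ≤ k`. -/
def SymState.Adm (σ : SymState) : Prop := 0 ≤ σ.z ∧ σ.z ≤ σ.a ∧ 0 ≤ σ.k

/-- A series edge preserves admissibility. -/
theorem SymState.Adm.series {σ : SymState} (h : σ.Adm) {r : ℝ} (hr0 : 0 ≤ r) (hr1 : r ≤ 1) :
    (SymState.series r σ).Adm := by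
  obtain ⟨hz, hza, hk⟩ := h
  refine ⟨?_, ?_, ?_⟩ <;> simp only [SymState.series] <;> nlinarith

/-- A gluing preserves admissibility. -/
theorem SymState.Adm.glue {σ τ : SymState} (hσ : σ.Adm) (hτ : τ.Adm) : (SymState.glue σ τ).Adm := by
  obtain ⟨hz, hza, hk⟩ := hσ
  obtain ⟨hz', hza', hk'⟩ := hτ
  refine ⟨?_, ?_, ?_⟩ <;> simp only [SymState.glue]
  · exact mul_nonneg hz hz'
  · exact mul_le_mul hza hza' hz' (le_trans hz hza)
  · exact mul_nonneg hk hk'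

/-- A mixture preserves admissibility. -/
theorem SymState.Adm.mix {σ τ : SymState} (hσ : σ.Adm) (hτ : τ.Adm) {p : ℝ} (hp0 : 0 ≤ p)
    (hp1 : p ≤ 1) : (SymState.mixS p σ τ).Adm := by
  obtain ⟨hz, hza, hk⟩ := hσ
  obtain ⟨hz', hza', hk'⟩ := hτ
  have h1p : 0 ≤ 1 - p := by linarith
  refine ⟨?_, ?_, ?_⟩ <;> simp only [SymState.mixS]
  · exact add_nonneg (mul_nonneg h1p hz) (mul_nonneg hp0 hz')
  · exact add_le_add (mul_le_mul_of_nonneg_left hza h1p) (mul_le_mul_of_nonneg_left hza' hp0)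
  · exact add_nonneg (mul_nonneg h1p hk) (mul_nonneg hp0 hk')

/-- The triangle state of an admissible `B` is admissible. -/
theorem triangleState_adm (r p : ℝ) (hr0 : 0 ≤ r) (hr1 : r ≤ 1) (hp0 : 0 ≤ p) (hp1 : p ≤ 1)
    {B : SymState} (hB : B.Adm) : (triangleState r p B).Adm := by
  have hq0 : 0 ≤ r * (2 - r) := mul_nonneg hr0 (by linarith)
  have hq1 : r * (2 - r) ≤ 1 := by nlinarith
  exact SymState.Adm.mix ((hB.series hr0 hr1).glue (hB.series hr0 hr1))
    ((hB.glue hB).series hq0 hq1) hp0 hp1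

/-- **T3 with a structure at the probe** (§15 (c), via LEMMA G2): `A ⊙ M(p)` satisfies C-028 for every
symmetric C-028 state `A` at the probe. -/
theorem t3_rooted_slack_nonneg (r p : ℝ) (hr0 : 0 ≤ r) (hr1 : r ≤ 1) (hp0 : 0 ≤ p) (hp1 : p ≤ 1)
    (A B : SymState) (hAz : 0 ≤ A.z) (hAa : A.z ≤ A.a) (hAk : 0 ≤ A.k) (hAC : 0 ≤ A.slack)
    (hz0 : 0 ≤ B.z) (hza : B.z ≤ B.a) (ha : 0 < B.a) (hk0 : 0 ≤ B.k) (hk1 : B.k ≤ 1)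
    (hC : 0 ≤ B.slack) : 0 ≤ (SymState.glue A (triangleState r p B)).slack := by
  obtain ⟨h1, h2, h3⟩ := triangleState_adm r p hr0 hr1 hp0 hp1 (B := B) ⟨hz0, hza, hk0⟩
  exact slack_glue_nonneg A _ hAz hAa hAk hAC h1 h2 h3
    (t3_slack_nonneg r p hr0 hr1 hp0 hp1 B hz0 hza ha hk0 hk1 hC)

end PercRepro
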